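import Mathlib
import HarnessLib
import Literature.MathematicalPhysics.QuantumLattice.KohnLuttinger
import Summits.HubbardSuperconductivity.HubbardSuperconductivity.Theorems.ChiralWindowCwKLChiralWindowD4Invariant
import Summits.HubbardSuperconductivity.HubbardSuperconductivity.Theorems.ChiralWindowCwKLChiralWindowGradient

/-!
# `stub_klD4Unitary`: the `D₄` composition operators on `L²(σ_μ)`

For the nearest-neighbour band `ε₀ = squareDispersion 1 0` and `μ ∈ (-4, 0)` the density-of-states
measure `σ_μ = fermiCurveMeasure ε₀ μ` is invariant under the point group `D₄` acting on momenta by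
`d4Momentum` (`stub_klD4Invariant`, with the gradient formula `stub_klGradient`).  Hence every
`g ∈ D₄` acts on `L²(σ_μ)` by the composition operator `U_g φ = φ ∘ (d4Momentum g)`
(Mathlib's `Lp.compMeasurePreservingₗᵢ`), a linear isometry.  We prove:

* the a.e. formula `U_g φ = φ ∘ g`, and `ψ ∘ g ∈ L²` for `ψ ∈ L²`;
* `U_1 = 1` and the product law `U_g U_h = U_{hg}` (`d4Momentum` is a LEFT action,
  `kl_du_d4Momentum_mul`, so `φ ↦ φ ∘ g` is a right action);
* `⟨U_g φ, U_g ψ⟩ = ⟨φ, ψ⟩` (isometry) and `⟨U_g φ, ψ⟩ = ⟨φ, U_{g⁻¹} ψ⟩` (unitarity);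
* every bounded operator `A` given a.e. by a `D₄`-invariant kernel, `(Aφ)(k) = ∫ K(k,k') φ(k') dσ`
  with `K(gk, gk') = K(k, k')`, commutes with all `U_g` (change of variables `k' ↦ g k'` in the
  kernel integral; `d4Momentum g` is a measurable bijection with inverse `d4Momentum g⁻¹`).

The whole argument is carried out abstractly (`kl_du_exists_ops`) for a left action `T` of a group
`G` by measure-preserving maps of a measure space `(α, ν)` on `Lp ℝ 2 ν`, then specialised to
`T = d4Momentum`, `ν = σ_μ`.  The action law `d4Momentum (g * h) = d4Momentum g ∘ d4Momentum h` is
checked on the generators (`rot⁴ = id`, `rotⁿ ∘ refl = refl ∘ rot³ⁿ`, exponents mod `4`).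
-/

noncomputable section

set_option linter.dupNamespace false

namespace Summit.HubbardSuperconductivity.HubbardSuperconductivity.Theorems

open MeasureTheory Literature.MathematicalPhysics.QuantumLattice
open scoped ENNReal

/-! ### Abstract part: composition operators of a measure-preserving left action on `L²` -/

section Abstract

variable {α : Type*} {G : Type*} [Group G] {T : G → α → α}

/-- For a left action `T` (`T (g h) = T g ∘ T h`, `T 1 = id`), `T g⁻¹` is a left inverse of
`T g`. [folklore] -/
theorem kl_du_inv_apply (hmul : ∀ g h x, T (g * h) x = T g (T h x)) (hone : ∀ x, T 1 x = x)
    (g : G) (x : α) : T g⁻¹ (T g x) = x := by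
  rw [← hmul, inv_mul_cancel, hone]

/-- For a left action `T`, `T g⁻¹` is a right inverse of `T g`. [folklore] -/
theorem kl_du_apply_inv (hmul : ∀ g h x, T (g * h) x = T g (T h x)) (hone : ∀ x, T 1 x = x)
    (g : G) (x : α) : T g (T g⁻¹ x) = x := by
  rw [← hmul, mul_inv_cancel, hone]

variable [MeasurableSpace α] {ν : Measure α}

/-- Each map `T g` of a left action by measurable maps is a measurable embedding (a measurable
bijection with measurable inverse `T g⁻¹`). [folklore] -/
theorem kl_du_measurableEmbedding (hT : ∀ g, MeasurePreserving (T g) ν ν)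
    (hmul : ∀ g h x, T (g * h) x = T g (T h x)) (hone : ∀ x, T 1 x = x) (g : G) :
    MeasurableEmbedding (T g) :=
  ({ toFun := T g, invFun := T g⁻¹, left_inv := kl_du_inv_apply hmul hone g,
     right_inv := kl_du_apply_inv hmul hone g, measurable_toFun := (hT g).measurable,
     measurable_invFun := (hT g⁻¹).measurable } : α ≃ᵐ α).measurableEmbedding

/-- `U_1 = 1`: composing with `T 1 = id` is the identity of `L²`. [folklore] -/
theorem kl_du_comp_one (hT : ∀ g, MeasurePreserving (T g) ν ν) (hone : ∀ x, T 1 x = x)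
    (φ : Lp ℝ 2 ν) : Lp.compMeasurePreserving (T 1) (hT 1) φ = φ :=
  Lp.ext <| (Lp.coeFn_compMeasurePreserving φ (hT 1)).mono fun x hx => by
    rw [hx, Function.comp_apply, hone]

/-- The product law `U_g (U_h φ) = U_{hg} φ` of the composition operators of a left action
(`(φ ∘ T h) ∘ T g = φ ∘ T (h g)`). [folklore] -/
theorem kl_du_comp_comp (hT : ∀ g, MeasurePreserving (T g) ν ν)
    (hmul : ∀ g h x, T (g * h) x = T g (T h x)) (g h : G) (φ : Lp ℝ 2 ν) :
    Lp.compMeasurePreserving (T g) (hT g) (Lp.compMeasurePreserving (T h) (hT h) φ) =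
      Lp.compMeasurePreserving (T (h * g)) (hT (h * g)) φ := by
  refine Lp.ext ?_
  filter_upwards [Lp.coeFn_compMeasurePreserving (Lp.compMeasurePreserving (T h) (hT h) φ) (hT g),
    (hT g).quasiMeasurePreserving.ae_eq (Lp.coeFn_compMeasurePreserving φ (hT h)),
    Lp.coeFn_compMeasurePreserving φ (hT (h * g))] with x hx hx' hx''
  rw [hx, hx', hx'']
  simp only [Function.comp_apply, hmul]

/-- A bounded operator on `L²` given a.e. by a `T`-invariant kernel `K (T g k) (T g k') = K k k'`
commutes with the composition operators: `A (φ ∘ T g) = (A φ) ∘ T g` (substitute `k' ↦ T g k'`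
in the kernel integral). [folklore] -/
theorem kl_du_comp_commute (hT : ∀ g, MeasurePreserving (T g) ν ν)
    (hmul : ∀ g h x, T (g * h) x = T g (T h x)) (hone : ∀ x, T 1 x = x)
    {K : α → α → ℝ} (hK : ∀ (g : G) (k k' : α), K (T g k) (T g k') = K k k')
    {A : Lp ℝ 2 ν →L[ℝ] Lp ℝ 2 ν}
    (hA : ∀ φ : Lp ℝ 2 ν, (A φ : α → ℝ) =ᵐ[ν] fun k => ∫ k', K k k' * φ k' ∂ν)
    (g : G) (φ : Lp ℝ 2 ν) :
    A (Lp.compMeasurePreserving (T g) (hT g) φ) =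
      Lp.compMeasurePreserving (T g) (hT g) (A φ) := by
  refine Lp.ext ?_
  have hemb := kl_du_measurableEmbedding hT hmul hone g
  have h2 : ∀ k, ∫ k', K k k' * (Lp.compMeasurePreserving (T g) (hT g) φ) k' ∂ν =
      ∫ k', K (T g k) k' * φ k' ∂ν := by
    intro k
    calc ∫ k', K k k' * (Lp.compMeasurePreserving (T g) (hT g) φ) k' ∂ν
        = ∫ k', (fun y => K (T g k) y * φ y) (T g k') ∂ν := by
          refine integral_congr_ae ?_
          filter_upwards [Lp.coeFn_compMeasurePreserving φ (hT g)] with k' hk'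
          rw [hk']
          simp only [Function.comp_apply, hK]
      _ = ∫ k', K (T g k) k' * φ k' ∂ν :=
          (hT g).integral_comp hemb fun y => K (T g k) y * φ y
  filter_upwards [hA (Lp.compMeasurePreserving (T g) (hT g) φ),
    Lp.coeFn_compMeasurePreserving (A φ) (hT g),
    (hT g).quasiMeasurePreserving.ae_eq (hA φ)] with k hk hk' hk''
  rw [hk, hk', hk'']
  simpa only [Function.comp_apply] using h2 k

/-- **Composition operators of a measure-preserving left action on `L²`.** For a left action `T`
of a group `G` on `(α, ν)` by measure-preserving maps there are bounded operators `U_g φ = φ ∘ T g`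
on `Lp ℝ 2 ν` with `U_1 = 1`, `U_g U_h = U_{hg}`, `⟨U_g φ, U_g ψ⟩ = ⟨φ, ψ⟩`,
`⟨U_g φ, ψ⟩ = ⟨φ, U_{g⁻¹} ψ⟩`, commuting with every bounded operator given a.e. by a
`T`-invariant kernel. [folklore] -/
theorem kl_du_exists_ops (hT : ∀ g, MeasurePreserving (T g) ν ν)
    (hmul : ∀ g h x, T (g * h) x = T g (T h x)) (hone : ∀ x, T 1 x = x) :
    ∃ U : G → (Lp ℝ 2 ν →L[ℝ] Lp ℝ 2 ν),
      (∀ (g : G) (φ : Lp ℝ 2 ν), (U g φ : α → ℝ) =ᵐ[ν] fun k => φ (T g k)) ∧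
      U 1 = 1 ∧
      (∀ g h : G, U g * U h = U (h * g)) ∧
      (∀ (g : G) (φ ψ : Lp ℝ 2 ν), inner ℝ (U g φ) (U g ψ) = inner ℝ φ ψ) ∧
      (∀ (g : G) (φ ψ : Lp ℝ 2 ν), inner ℝ (U g φ) ψ = inner ℝ φ (U g⁻¹ ψ)) ∧
      (∀ (K : α → α → ℝ) (A : Lp ℝ 2 ν →L[ℝ] Lp ℝ 2 ν),
        (∀ (g : G) (k k' : α), K (T g k) (T g k') = K k k') →
        (∀ φ : Lp ℝ 2 ν, (A φ : α → ℝ) =ᵐ[ν] fun k => ∫ k', K k k' * φ k' ∂ν) →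
        ∀ g : G, A * U g = U g * A) := by
  obtain ⟨U, hU⟩ : ∃ U : G → (Lp ℝ 2 ν →L[ℝ] Lp ℝ 2 ν),
      ∀ g, U g = (Lp.compMeasurePreservingₗᵢ ℝ (T g) (hT g)).toContinuousLinearMap :=
    ⟨_, fun _ => rfl⟩
  have hUapp : ∀ (g : G) (φ : Lp ℝ 2 ν), U g φ = Lp.compMeasurePreserving (T g) (hT g) φ :=
    fun g φ => by rw [hU]; rfl
  have h1 : U 1 = 1 := ContinuousLinearMap.ext fun φ => by
    rw [hUapp, kl_du_comp_one hT hone, one_apply_eq_self]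
  have hprod : ∀ g h : G, U g * U h = U (h * g) := fun g h =>
    ContinuousLinearMap.ext fun φ => by
      rw [mul_apply_eq_comp, hUapp, hUapp, hUapp, kl_du_comp_comp hT hmul]
  have hinner : ∀ (g : G) (φ ψ : Lp ℝ 2 ν), inner ℝ (U g φ) (U g ψ) = inner ℝ φ ψ :=
    fun g φ ψ => by
      rw [hU]
      exact (Lp.compMeasurePreservingₗᵢ ℝ (T g) (hT g)).inner_map_map φ ψ
  refine ⟨U, fun g φ => ?_, h1, hprod, hinner, fun g φ ψ => ?_, fun K A hK hA g => ?_⟩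
  · rw [hUapp]
    exact Lp.coeFn_compMeasurePreserving φ (hT g)
  · rw [← hinner g⁻¹ (U g φ) ψ, ← mul_apply_eq_comp (U g⁻¹) (U g) φ, hprod, mul_inv_cancel, h1,
      one_apply_eq_self]
  · exact ContinuousLinearMap.ext fun φ => by
      rw [mul_apply_eq_comp, mul_apply_eq_comp, hUapp, hUapp]
      exact kl_du_comp_commute hT hmul hone hK hA g φ

end Abstract

/-! ### `d4Momentum` is a left action of `D₄` -/

/-- `rotⁿ k` only depends on `n` modulo `4` (`rot⁴ = id`). [folklore] -/
theorem kl_du_rot_iterate_mod (n : ℕ) (k : Momentum) :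
    rotMomentum^[n] k = rotMomentum^[n % 4] k := by
  have h4 : rotMomentum^[4] = id := funext fun k => kl_d4_rot_rot_rot_rot k
  calc rotMomentum^[n] k = rotMomentum^[n % 4 + 4 * (n / 4)] k := by rw [Nat.mod_add_div]
    _ = rotMomentum^[n % 4] k := by
      rw [Function.iterate_add_apply, Function.iterate_mul, h4, Function.iterate_id, id_eq]

/-- Iterates of `rot` with exponents congruent modulo `4` agree. [folklore] -/
theorem kl_du_rot_iterate_congr {m n : ℕ} (h : m % 4 = n % 4) (k : Momentum) :
    rotMomentum^[m] k = rotMomentum^[n] k := by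
  rw [kl_du_rot_iterate_mod m, h, ← kl_du_rot_iterate_mod n]

/-- `rot ∘ refl = refl ∘ rot³`. [folklore] -/
theorem kl_du_rot_refl (k : Momentum) :
    rotMomentum (reflMomentum k) = reflMomentum (rotMomentum (rotMomentum (rotMomentum k))) := by
  ext i
  fin_cases i <;> simp

/-- `rotⁿ ∘ refl = refl ∘ rot³ⁿ`. [folklore] -/
theorem kl_du_rot_iterate_refl (n : ℕ) (k : Momentum) :
    rotMomentum^[n] (reflMomentum k) = reflMomentum (rotMomentum^[3 * n] k) := by
  induction n with
  | zero => rfl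
  | succ n ih =>
    rw [Function.iterate_succ_apply', ih, kl_du_rot_refl,
      show 3 * (n + 1) = 3 + 3 * n by ring, Function.iterate_add_apply]
    rfl

/-- Exponent bookkeeping in `ZMod 4` for the action law. [folklore] -/
theorem kl_du_zmod_val :
    (∀ i j : ZMod 4, (i + j).val % 4 = (i.val + j.val) % 4) ∧
      (∀ i j : ZMod 4, (j - i).val % 4 = (3 * i.val + j.val) % 4) := by
  constructor <;> decide

/-- **`d4Momentum` is a left action**: `d4Momentum (g h) = d4Momentum g ∘ d4Momentum h`
(`r i ↦ rotⁱ`, `sr i ↦ refl ∘ rotⁱ`, `sr i = s rⁱ` in Mathlib's `DihedralGroup`). [folklore] -/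
theorem kl_du_d4Momentum_mul (g h : DihedralGroup 4) (k : Momentum) :
    d4Momentum (g * h) k = d4Momentum g (d4Momentum h k) := by
  rcases g with i | i <;> rcases h with j | j
  · simp only [DihedralGroup.r_mul_r, d4Momentum]
    rw [← Function.iterate_add_apply]
    exact kl_du_rot_iterate_congr (kl_du_zmod_val.1 i j) k
  · simp only [DihedralGroup.r_mul_sr, d4Momentum]
    rw [kl_du_rot_iterate_refl, ← Function.iterate_add_apply]
    exact congrArg reflMomentum (kl_du_rot_iterate_congr (kl_du_zmod_val.2 i j) k)
  · simp only [DihedralGroup.sr_mul_r, d4Momentum]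
    rw [← Function.iterate_add_apply]
    exact congrArg reflMomentum (kl_du_rot_iterate_congr (kl_du_zmod_val.1 i j) k)
  · simp only [DihedralGroup.sr_mul_sr, d4Momentum]
    rw [kl_du_rot_iterate_refl, kl_d4_refl_refl, ← Function.iterate_add_apply]
    exact kl_du_rot_iterate_congr (kl_du_zmod_val.2 i j) k

/-! ### The stub -/

/-- **The `D₄` composition operators on `L²(σ_μ)`.** For `μ ∈ (-4,0)` (where `σ_μ` is `D₄`-invariant) the maps
`U_g φ = φ ∘ g` are isometries of `L²(σ_μ)` with `U_1 = 1`, `U_g U_h = U_{hg}`, `U_g* = U_{g⁻¹}`, and they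
commute with the integral operator of every `D₄`-invariant `L²` kernel. [folklore] -/
theorem stub_klD4Unitary : ∀ μ ∈ Set.Ioo (-4 : ℝ) 0,
    ∃ U : DihedralGroup 4 →
        (Lp ℝ 2 (fermiCurveMeasure (squareDispersion 1 0) μ) →L[ℝ] Lp ℝ 2 (fermiCurveMeasure (squareDispersion 1 0) μ)),
      (∀ (g : DihedralGroup 4) (φ : Lp ℝ 2 (fermiCurveMeasure (squareDispersion 1 0) μ)),
        (U g φ : Momentum → ℝ) =ᵐ[fermiCurveMeasure (squareDispersion 1 0) μ] fun k => φ (d4Momentum g k)) ∧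
      (∀ (g : DihedralGroup 4) (ψ : Momentum → ℝ), MemLp ψ 2 (fermiCurveMeasure (squareDispersion 1 0) μ) →
        MemLp (fun k => ψ (d4Momentum g k)) 2 (fermiCurveMeasure (squareDispersion 1 0) μ)) ∧
      U 1 = 1 ∧
      (∀ g h : DihedralGroup 4, U g * U h = U (h * g)) ∧
      (∀ (g : DihedralGroup 4) (φ ψ : Lp ℝ 2 (fermiCurveMeasure (squareDispersion 1 0) μ)),
        inner ℝ (U g φ) (U g ψ) = inner ℝ φ ψ) ∧
      (∀ (g : DihedralGroup 4) (φ ψ : Lp ℝ 2 (fermiCurveMeasure (squareDispersion 1 0) μ)),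
        inner ℝ (U g φ) ψ = inner ℝ φ (U g⁻¹ ψ)) ∧
      (∀ (K : Momentum → Momentum → ℝ)
        (A : Lp ℝ 2 (fermiCurveMeasure (squareDispersion 1 0) μ) →L[ℝ] Lp ℝ 2 (fermiCurveMeasure (squareDispersion 1 0) μ)),
        (∀ (g : DihedralGroup 4) (k k' : Momentum), K (d4Momentum g k) (d4Momentum g k') = K k k') →
        MemLp (Function.uncurry K) 2
          ((fermiCurveMeasure (squareDispersion 1 0) μ).prod (fermiCurveMeasure (squareDispersion 1 0) μ)) →
        (∀ φ : Lp ℝ 2 (fermiCurveMeasure (squareDispersion 1 0) μ),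
          (A φ : Momentum → ℝ) =ᵐ[fermiCurveMeasure (squareDispersion 1 0) μ]
            fun k => ∫ k', K k k' * φ k' ∂fermiCurveMeasure (squareDispersion 1 0) μ) →
        ∀ g : DihedralGroup 4, A * U g = U g * A) := by
  intro μ hμ
  have hT : ∀ g : DihedralGroup 4, MeasurePreserving (d4Momentum g)
      (fermiCurveMeasure (squareDispersion 1 0) μ) (fermiCurveMeasure (squareDispersion 1 0) μ) :=
    stub_klD4Invariant stub_klGradient μ hμ
  obtain ⟨U, hae, h1, hprod, hinner, hadj, hcomm⟩ :=
    kl_du_exists_ops hT kl_du_d4Momentum_mul d4Momentum_one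
  exact ⟨U, hae, fun g ψ hψ => hψ.comp_measurePreserving (hT g), h1, hprod, hinner, hadj,
    fun K A hK _ hA g => hcomm K A hK hA g⟩

end Summit.HubbardSuperconductivity.HubbardSuperconductivity.Theorems

end
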